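import Summits.AtomisticToContinuum.HydrodynamicLimit.Theorems.EnskogAdjointDualityEquilibriumCollisionResidualCentring
import Summits.AtomisticToContinuum.HydrodynamicLimit.Theorems.EnskogAdjointDualityDualityReductionLMeasurable
import HarnessLib

/-!
# K2R transfer bound IV: measurability and integrability of the position × direction integrand

Route `EnskogAdjointDuality` of `AtomisticToContinuum/HydrodynamicLimit`, crux `AdjointEnskogTestFamilyR`
(stmt-AtomisticToContinuum-11592, "K2R"), line `birth`, stub `stub_transferBound` (G3b), helper IV.

The reduced transfer `T = ∫_{S²} ∫_{𝕋³} F(ω, x) dx dσ(ω)` has the integrand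
`F = −Y(x+εω/2) ρ(x) ρ(x+εω) [ (β(x)−β(x+εω))·ω · J₁(ω,x) + (γ(x)−γ(x+εω)) · J₂(ω,x) ]` whose only
non-continuous ingredients are the Gaussian pair integrals `J₁, J₂` (double velocity integrals of the two
local Maxwellians at `x` and `x+εω`).  To split `∫(F − F₀)` and `∫_{S²}(A + εB)` in the `O(ε²)` estimate one
needs their measurability:

* `k2r_tb_stronglyMeasurable_pair₁/₂` — `J₁, J₂` are strongly measurable on `S² × 𝕋³` (continuity of the
  four-variable integrand and `StronglyMeasurable.integral_prod_right'` twice);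
* `k2r_tb_stronglyMeasurable_F` — hence so is `F` for continuous slices and coefficients;
* `k2r_tb_integrable_sections` — a bounded strongly measurable function on `S² × 𝕋³` has integrable
  `x`-sections and an integrable `x`-marginal (registered sub-goal `stub_transferBound_measurable`).

References: C. Cercignani, R. Illner, M. Pulvirenti, *The Mathematical Theory of Dilute Gases* (1994),
§3.1 [CIP1994] (the Enskog collision operator); folklore measure theory.
-/

noncomputable section

open MeasureTheory Metric Set Filter Topology Function
open scoped InnerProductSpace

namespace Summit.AtomisticToContinuum.HydrodynamicLimit.Theorems.EnskogAdjointDuality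

open Literature.Analysis.FluidPDE Literature.MathematicalPhysics.KineticTheory

/-! ## Strong measurability of the pair integrals on `S² × 𝕋³` -/

section Pair

variable {θ₀ : T3 → ℝ} {u₀ : T3 → V3}

/-- Joint continuity of the four-variable integrand of the pair integrals: for continuous `θ₀ > 0`, `u₀`
and a continuous weight `k(ω, v, w)`,
`((ω, x), v, w) ↦ k(ω,v,w) M_{θ₀(x),u₀(x)}(v) M_{θ₀(x+εω),u₀(x+εω)}(w)` is continuous. [folklore] -/
theorem k2r_tb_continuous_pair_integrand (hθc : Continuous θ₀) (hθpos : ∀ x, 0 < θ₀ x)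
    (huc : Continuous u₀) (ε : ℝ) {k : sphere (0 : V3) 1 → V3 → V3 → ℝ}
    (hk : Continuous fun q : sphere (0 : V3) 1 × V3 × V3 => k q.1 q.2.1 q.2.2) :
    Continuous fun r : ((sphere (0 : V3) 1 × T3) × V3) × V3 =>
      k r.1.1.1 r.1.2 r.2 * (localMaxwellian 1 (θ₀ r.1.1.2) (u₀ r.1.1.2) r.1.2 *
        localMaxwellian 1 (θ₀ ((Torus.geometry (Fin 3)).translate r.1.1.2 (ε • (r.1.1.1 : V3))))
          (u₀ ((Torus.geometry (Fin 3)).translate r.1.1.2 (ε • (r.1.1.1 : V3)))) r.2) := by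
  have hx : Continuous fun r : ((sphere (0 : V3) 1 × T3) × V3) × V3 => r.1.1.2 := by fun_prop
  have hω : Continuous fun r : ((sphere (0 : V3) 1 × T3) × V3) × V3 => r.1.1.1 := by fun_prop
  have hv : Continuous fun r : ((sphere (0 : V3) 1 × T3) × V3) × V3 => r.1.2 := by fun_prop
  have hw : Continuous fun r : ((sphere (0 : V3) 1 × T3) × V3) × V3 => r.2 := by fun_prop
  have hy : Continuous fun r : ((sphere (0 : V3) 1 × T3) × V3) × V3 =>
      (Torus.geometry (Fin 3)).translate r.1.1.2 (ε • (r.1.1.1 : V3)) :=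
    (continuous_torus_translate_sphere ε).comp (hx.prodMk hω)
  have hk' : Continuous fun r : ((sphere (0 : V3) 1 × T3) × V3) × V3 => k r.1.1.1 r.1.2 r.2 :=
    hk.comp (hω.prodMk (hv.prodMk hw))
  refine hk'.mul ((continuous_localMaxwellian_param (hθc.comp hx) (fun _ => hθpos _)
    (huc.comp hx) hv).mul
    (continuous_localMaxwellian_param (hθc.comp hy) (fun _ => hθpos _) (huc.comp hy) hw))

/-- **Strong measurability of a Maxwellian pair integral on `S² × 𝕋³`.** For continuous `θ₀ > 0`, `u₀`,
a continuous weight `k` and every `ε`,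
`(ω, x) ↦ ∫∫ k(ω,v,w) M_{θ₀(x),u₀(x)}(v) M_{θ₀(x+εω),u₀(x+εω)}(w) dw dv` is strongly measurable
(`StronglyMeasurable.integral_prod_right'` twice). [folklore] -/
theorem k2r_tb_stronglyMeasurable_pair (hθc : Continuous θ₀) (hθpos : ∀ x, 0 < θ₀ x)
    (huc : Continuous u₀) (ε : ℝ) {k : sphere (0 : V3) 1 → V3 → V3 → ℝ}
    (hk : Continuous fun q : sphere (0 : V3) 1 × V3 × V3 => k q.1 q.2.1 q.2.2) :
    StronglyMeasurable fun p : sphere (0 : V3) 1 × T3 => ∫ v : V3, ∫ w : V3,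
      k p.1 v w * (localMaxwellian 1 (θ₀ p.2) (u₀ p.2) v *
        localMaxwellian 1 (θ₀ ((Torus.geometry (Fin 3)).translate p.2 (ε • (p.1 : V3))))
          (u₀ ((Torus.geometry (Fin 3)).translate p.2 (ε • (p.1 : V3)))) w) := by
  have h := (k2r_tb_continuous_pair_integrand hθc hθpos huc ε hk).stronglyMeasurable
  exact (h.integral_prod_right' (ν := (volume : Measure V3))).integral_prod_right'

/-- The kernel of `J₁`, `(ω, v, w) ↦ ((v−w)·ω)₊ (v−w)·ω`, is continuous. [folklore] -/
theorem k2r_tb_continuous_kernel₁ :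
    Continuous fun q : sphere (0 : V3) 1 × V3 × V3 =>
      max ⟪q.2.1 - q.2.2, (q.1 : V3)⟫_ℝ 0 * ⟪q.2.1 - q.2.2, (q.1 : V3)⟫_ℝ := by
  fun_prop

/-- The kernel of `J₂`, `(ω, v, w) ↦ ((v−w)·ω)₊ ((v−w)·ω) ((v+w)·ω/2)`, is continuous. [folklore] -/
theorem k2r_tb_continuous_kernel₂ :
    Continuous fun q : sphere (0 : V3) 1 × V3 × V3 =>
      max ⟪q.2.1 - q.2.2, (q.1 : V3)⟫_ℝ 0 * ⟪q.2.1 - q.2.2, (q.1 : V3)⟫_ℝ *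
        (⟪q.2.1 + q.2.2, (q.1 : V3)⟫_ℝ / 2) := by
  fun_prop

end Pair

/-! ## Strong measurability of the transfer integrand -/

/-- **Strong measurability of the position × direction transfer integrand.** For continuous slices
`ρ₀`, `θ₀ > 0`, `u₀`, a continuous contact factor `Yc`, continuous coefficients `c₀ = (α, β, γ)` and every
`ε`, the integrand `F(ω, x) = −Yc(x+εω/2) ρ₀(x) ρ₀(y) [ (β(x)−β(y))·ω J₁ + (γ(x)−γ(y)) J₂ ]`, `y = x+εω`,
is strongly measurable on `S² × 𝕋³`. [cite: CIP1994, §3.1] -/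
theorem k2r_tb_stronglyMeasurable_F {ρ₀ θ₀ : T3 → ℝ} {u₀ : T3 → V3} {Yc : T3 → ℝ}
    {c₀ : T3 → ℝ × V3 × ℝ} (hρc : Continuous ρ₀) (hθc : Continuous θ₀) (hθpos : ∀ x, 0 < θ₀ x)
    (huc : Continuous u₀) (hYc : Continuous Yc) (hcc : Continuous c₀) (ε : ℝ) :
    StronglyMeasurable fun p : sphere (0 : V3) 1 × T3 =>
      -(Yc ((Torus.geometry (Fin 3)).translate p.2 ((ε / 2) • (p.1 : V3))) * ρ₀ p.2 *
          ρ₀ ((Torus.geometry (Fin 3)).translate p.2 (ε • (p.1 : V3)))) *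
        (⟪(c₀ p.2).2.1 - (c₀ ((Torus.geometry (Fin 3)).translate p.2 (ε • (p.1 : V3)))).2.1, (p.1 : V3)⟫_ℝ *
          (∫ v : V3, ∫ w : V3, max ⟪v - w, (p.1 : V3)⟫_ℝ 0 * ⟪v - w, (p.1 : V3)⟫_ℝ *
            (localMaxwellian 1 (θ₀ p.2) (u₀ p.2) v *
              localMaxwellian 1 (θ₀ ((Torus.geometry (Fin 3)).translate p.2 (ε • (p.1 : V3))))
                (u₀ ((Torus.geometry (Fin 3)).translate p.2 (ε • (p.1 : V3)))) w)) +
        ((c₀ p.2).2.2 - (c₀ ((Torus.geometry (Fin 3)).translate p.2 (ε • (p.1 : V3)))).2.2) *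
          (∫ v : V3, ∫ w : V3, max ⟪v - w, (p.1 : V3)⟫_ℝ 0 * ⟪v - w, (p.1 : V3)⟫_ℝ *
            (⟪v + w, (p.1 : V3)⟫_ℝ / 2) *
            (localMaxwellian 1 (θ₀ p.2) (u₀ p.2) v *
              localMaxwellian 1 (θ₀ ((Torus.geometry (Fin 3)).translate p.2 (ε • (p.1 : V3))))
                (u₀ ((Torus.geometry (Fin 3)).translate p.2 (ε • (p.1 : V3)))) w))) := by
  have hy : Continuous fun p : sphere (0 : V3) 1 × T3 =>
      (Torus.geometry (Fin 3)).translate p.2 (ε • (p.1 : V3)) :=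
    (continuous_torus_translate_sphere ε).comp (continuous_snd.prodMk continuous_fst)
  have hyh : Continuous fun p : sphere (0 : V3) 1 × T3 =>
      (Torus.geometry (Fin 3)).translate p.2 ((ε / 2) • (p.1 : V3)) :=
    (continuous_torus_translate_sphere (ε / 2)).comp (continuous_snd.prodMk continuous_fst)
  have hω : Continuous fun p : sphere (0 : V3) 1 × T3 => (p.1 : V3) := by fun_prop
  have hpre : Continuous fun p : sphere (0 : V3) 1 × T3 =>
      -(Yc ((Torus.geometry (Fin 3)).translate p.2 ((ε / 2) • (p.1 : V3))) * ρ₀ p.2 *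
        ρ₀ ((Torus.geometry (Fin 3)).translate p.2 (ε • (p.1 : V3)))) :=
    (((hYc.comp hyh).mul (hρc.comp continuous_snd)).mul (hρc.comp hy)).neg
  have hdβ : Continuous fun p : sphere (0 : V3) 1 × T3 =>
      ⟪(c₀ p.2).2.1 - (c₀ ((Torus.geometry (Fin 3)).translate p.2 (ε • (p.1 : V3)))).2.1, (p.1 : V3)⟫_ℝ := by
    have h1 : Continuous fun p : sphere (0 : V3) 1 × T3 => (c₀ p.2).2.1 := by fun_prop
    have h2 : Continuous fun p : sphere (0 : V3) 1 × T3 =>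
        (c₀ ((Torus.geometry (Fin 3)).translate p.2 (ε • (p.1 : V3)))).2.1 :=
      (continuous_fst.comp (continuous_snd.comp (hcc.comp hy)))
    exact (h1.sub h2).inner hω
  have hdγ : Continuous fun p : sphere (0 : V3) 1 × T3 =>
      (c₀ p.2).2.2 - (c₀ ((Torus.geometry (Fin 3)).translate p.2 (ε • (p.1 : V3)))).2.2 := by
    have h1 : Continuous fun p : sphere (0 : V3) 1 × T3 => (c₀ p.2).2.2 := by fun_prop
    have h2 : Continuous fun p : sphere (0 : V3) 1 × T3 =>
        (c₀ ((Torus.geometry (Fin 3)).translate p.2 (ε • (p.1 : V3)))).2.2 :=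
      (continuous_snd.comp (continuous_snd.comp (hcc.comp hy)))
    exact h1.sub h2
  have hJ₁ := k2r_tb_stronglyMeasurable_pair hθc hθpos huc ε
    (k := fun ω v w => max ⟪v - w, (ω : V3)⟫_ℝ 0 * ⟪v - w, (ω : V3)⟫_ℝ) k2r_tb_continuous_kernel₁
  have hJ₂ := k2r_tb_stronglyMeasurable_pair hθc hθpos huc ε
    (k := fun ω v w => max ⟪v - w, (ω : V3)⟫_ℝ 0 * ⟪v - w, (ω : V3)⟫_ℝ * (⟪v + w, (ω : V3)⟫_ℝ / 2))
    k2r_tb_continuous_kernel₂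
  exact hpre.stronglyMeasurable.mul ((hdβ.stronglyMeasurable.mul hJ₁).add (hdγ.stronglyMeasurable.mul hJ₂))

/-! ## Integrable sections and marginals of bounded measurable functions on `S² × 𝕋³` -/

/-- **Bounded strongly measurable functions on `S² × 𝕋³` have integrable sections and marginals.** If
`f : S² × 𝕋³ → ℝ` is strongly measurable with `|f| ≤ B`, then every section `f(ω, ·)` is integrable on
`𝕋³`, `|∫ f(ω, x) dx| ≤ B`, and the marginal `ω ↦ ∫ f(ω, x) dx` is integrable on `S²`
(`vol(𝕋³) = 1`, `σ(S²) < ∞`). [folklore] -/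
theorem k2r_tb_integrable_sections {f : sphere (0 : V3) 1 × T3 → ℝ} (hf : StronglyMeasurable f) {B : ℝ}
    (hB : ∀ p, |f p| ≤ B) :
    (∀ ω, Integrable (fun x : T3 => f (ω, x))) ∧ (∀ ω, |∫ x : T3, f (ω, x)| ≤ B) ∧
      Integrable (fun ω => ∫ x : T3, f (ω, x)) (sphereMeasure : Measure (sphere (0 : V3) 1)) := by
  haveI := isFiniteMeasure_sphereMeasure (E := V3)
  have hsec : ∀ ω : sphere (0 : V3) 1, StronglyMeasurable fun x : T3 => f (ω, x) := fun ω =>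
    hf.comp_measurable measurable_prodMk_left
  have h1 : ∀ ω, Integrable (fun x : T3 => f (ω, x)) := fun ω =>
    (integrable_const B).mono' (hsec ω).aestronglyMeasurable
      (Eventually.of_forall fun x => by rw [Real.norm_eq_abs]; exact hB _)
  have h2 : ∀ ω, |∫ x : T3, f (ω, x)| ≤ B := fun ω => by
    have h := norm_integral_le_of_norm_le_const (μ := (volume : Measure T3)) (f := fun x => f (ω, x))
      (C := B) (Eventually.of_forall fun x => by rw [Real.norm_eq_abs]; exact hB _)
    rwa [probReal_univ, mul_one, Real.norm_eq_abs] at h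
  refine ⟨h1, h2, (integrable_const B).mono' (hf.integral_prod_right' (ν := (volume : Measure T3))
    ).aestronglyMeasurable (Eventually.of_forall fun ω => ?_)⟩
  rw [Real.norm_eq_abs]
  exact h2 ω

/-- **Registered sub-goal `stub_transferBound_measurable`** (K2R line `birth`, stub G3b, helper IV):
integrable sections and marginals of bounded strongly measurable functions on `S² × 𝕋³`
(`k2r_tb_integrable_sections`), as a closed statement. [folklore] -/
theorem stub_transferBound_measurable :
    ∀ (f : Metric.sphere (0 : EuclideanSpace ℝ (Fin 3)) 1 × UnitAddTorus (Fin 3) → ℝ),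
    MeasureTheory.StronglyMeasurable f → ∀ (B : ℝ), (∀ p, |f p| ≤ B) →
    (∀ ω, MeasureTheory.Integrable (fun x : UnitAddTorus (Fin 3) => f (ω, x))) ∧
      (∀ ω, |∫ x : UnitAddTorus (Fin 3), f (ω, x)| ≤ B) ∧
      MeasureTheory.Integrable (fun ω => ∫ x : UnitAddTorus (Fin 3), f (ω, x))
        (Literature.MathematicalPhysics.KineticTheory.sphereMeasure :
          MeasureTheory.Measure (Metric.sphere (0 : EuclideanSpace ℝ (Fin 3)) 1)) :=
  fun _ hf _ hB => k2r_tb_integrable_sections hf hB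

end Summit.AtomisticToContinuum.HydrodynamicLimit.Theorems.EnskogAdjointDuality

end
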